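import Mathlib
import Summits.NavierStokesRegularity.NavierStokesRegularity.Theses.EulerZoomLiouville
import Summits.NavierStokesRegularity.NavierStokesRegularity.Theorems.EulerZoomLiouvillePowerGaugeEulerLiouvilleLargeRho
import Summits.NavierStokesRegularity.NavierStokesRegularity.Theorems.EulerZoomLiouvillePowerGaugeEulerLiouvillePastFramePeriodic
import Summits.NavierStokesRegularity.NavierStokesRegularity.Theorems.EulerZoomLiouvillePowerGaugeEulerLiouvillePastFrameSteadyTools
import Summits.NavierStokesRegularity.NavierStokesRegularity.Theorems.EulerZoomLiouvillePowerGaugeEulerLiouvillePastFrameSteadyConfined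
import Summits.NavierStokesRegularity.NavierStokesRegularity.Theorems.EulerZoomLiouvillePowerGaugeEulerLiouvilleGalileanAffineLowerBound
import Summits.NavierStokesRegularity.NavierStokesRegularity.Theorems.EulerZoomLiouvillePowerGaugeEulerLiouvilleGalileanFictitiousForce
import Summits.NavierStokesRegularity.NavierStokesRegularity.Theorems.EulerZoomLiouvillePowerGaugeEulerLiouvilleGalileanHarmonicShear
import Summits.NavierStokesRegularity.NavierStokesRegularity.Theorems.EulerZoomLiouvillePowerGaugeEulerLiouvilleGalileanFrameSteady
import Summits.NavierStokesRegularity.NavierStokesRegularity.Theorems.EulerZoomLiouvillePowerGaugeEulerLiouvilleGalileanWandering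
import Literature.Analysis.FluidPDE.SelfSimilarCollapseAnsatz
import Literature.Analysis.FluidPDE.VectorCalculus
import HarnessLib.Audit
import Summits.NavierStokesRegularity.NavierStokesRegularity.Theorems.EulerZoomLiouvillePowerGaugeEulerLiouvilleRotatingFrameSteady
import Summits.NavierStokesRegularity.NavierStokesRegularity.Theorems.EulerZoomLiouvillePowerGaugeEulerLiouvilleRigidFrameSteady
import Summits.NavierStokesRegularity.NavierStokesRegularity.Theorems.EulerZoomLiouvillePowerGaugeEulerLiouvilleRotoPeriodic

/-!
# Line `galilean-frames` (ideator ns-idea-11 g6, lens «complete» = program-completion) for the crux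
# `EulerZoomLiouville.PowerGaugeEulerLiouville` (stmt-NavierStokesRegularity-19832)

PROGRAMME COMPLETED (second half of the symmetry classification; companion of `Lines/relative_equilibria.lean`, which files the
`O(3)`-twisted slice).  The symmetry group of the incompressible Euler equations (Majda–Bertozzi, *Vorticity and Incompressible Flow*,
Prop. 1.1, p. 12: Galilean boosts, rotations, the two-parameter scalings; plus the classical EXTENDED Galilean invariance
`v(x,t) ↦ v(x − ξ(t), t) + ξ'(t)`, `p ↦ p(x − ξ(t), t) − ξ''(t)·(x − ξ(t))` for an arbitrary `C²` frame path `ξ`) acts on candidate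
blow-up profiles, and every Liouville theorem in print for symmetric ancient/self-similar Euler flows (Chae 2007; Chae–Tsai 2014;
Bronzi–Shvydkoy 2015; CIV 2026 §3; the LEAD's v62 strata) is stated for the ANCHORED representative: steady, time-periodic,
self-similar about a FIXED centre, traveling with CONSTANT velocity.  This line files the RELATIVE EQUILIBRIA MODULO THE EXTENDED
GALILEI GROUP — states that are steady in an arbitrarily translating frame with an arbitrary uniform background (`IsPastFrameSteady`),
periodic up to a spatial hop and a boost (`IsPastFramePeriodic`), or self-similar about a WANDERING centre `ξ(τ)` with a background
drift (`IsPastWandering…`) — and proves them RIGID: in Seregin's gauged class every such member is an anchored one.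

THE LEVERS («the gauge breaks Galilean relativity: the class has a preferred rest frame pinned at spatial infinity, and the
pressure gauge sees fictitious forces»).
(L1) MEAN-VELOCITY PINNING (A-gauge at infinite scale, two slices).  If two slices of a member are the SAME profile up to a shift and
     two uniform backgrounds, `u(τᵢ) = U(· − ξᵢ) + ηᵢ`, then on the common ball `B_{a/4} ⊂ (B_a − ξ₁) ∩ (B_a − ξ₂)` both `U + η₁` and
     `U + η₂` have `L²`-mass `≤ c a^{1−2ρ}`, so `|η₁ − η₂|² a³ ≲ a^{1−2ρ}` and `a → ∞` gives `η₁ = η₂`: uniform backgrounds are constant,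
     boosts of periodic orbits vanish (F2), and — run in similarity variables, where the identity is scale-invariant — the Galilean
     boost of a self-similar member vanishes (F3).
(L2) FRAME ACCELERATION IS A HARMONIC GRADIENT (weak Euler, two slices).  For `u(τ) = Ũ(· − ξ(τ))` the weak momentum equation at two
     times gives `((ξ'(τ₁) − ξ'(τ₂))·∇)Ũ = ∇q`, `Δq = 0`; the harmonic vector `∂_e Ũ` has mean-value decay
     `|∂_eŨ(x₀)| ≲ R^{−5/2}‖Ũ + κ‖_{L²(B_{2R}(x₀))} ≲ R^{−2−ρ} → 0` under the A-gauge, so `Ũ` is invariant along every direction of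
     `D = span{ξ'(τ₁) − ξ'(τ₂)}` and the path is affine modulo `D`: the member IS a traveling wave (F1 ⇒ the LEAD's
     `PastTravel.ae_eq_zero_of_gauge_of_pastTravelingWave`, p600154).
(L3) FICTITIOUS FORCES ARE LINEAR PRESSURES, AND THE D-GAUGE FORBIDS THEM (two-point affine lower bound).  For a wandering
     self-similar member the weak Euler equation forces `p(τ,y) = (T−τ)^{2γ−2}[P̄(Y) − b(τ)·Y + c₁(τ)]`, `Y = (T−τ)^{−γ}(y − ξ(τ))`,
     `b(τ) = (T−τ)^{2−γ} ξ''(τ)`, with ONE profile pressure `P̄`; if `b` took two values on sets of positive measure, the change of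
     variables in `∫∫_{Q_a}|p|^{3/2} ≤ c a^{2−2ρ}` and `inf_c ∫_{B_L}|(b₁−b₂)·Y − c|^{3/2} ≳ |b₁−b₂|^{3/2} L^{9/2}` would give `a^{9/2} ≲ a^{2−2ρ}`.
     Hence `ξ'' = ℓ (T−τ)^{γ−2}`, i.e. `ξ(τ) = x₀ + w(τ−T) + m (T−τ)^γ`, and the `(T−τ)^γ`-term is the similarity-variable translation
     `V ↦ V(· − m) − γ m` (the centre parameter of `Literature…selfSimilarTransport`): the member is a BOOSTED anchored self-similar
     member, and the boost dies by (L1).  So F3 reduces wandering members EXACTLY to the past-window ANCHORED SELF-SIMILAR COLUMN F4 =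
     the LEAD's `IsPastSelfSimilar ρ T T₁ x₀ u V` binder existentially closed (ANY centre `(T, x₀)`, ANY profile, past window): the
     LEAD's FILLED past-window strata ∪ the origin-anchored open residues `stub_selfSimilarC2Needle` / `stub_selfSimilarWeakRest` ∪ the
     N55-translated (off-centre / interior-time) needles now sitting in `stub_nonSelfSimilarRest` — every open part stays OPEN, F4 is NOT
     claimed here (label = critic V48 P1).
No new residue is created: the Galilean-twisted slice is EMPTY beyond the anchored one (contrast: the `O(3)`-twisted slice of the
companion line leaves spiral needles).  F5 (`stub_nonGalileanRest`, OPEN) is the complement of the stratum — the crux restricted, not claimed.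

REV2 (critic V48 P1–P3; width): F2 `stub_framePeriodic` is FILLED BY NAME — ns-ezl-w6 g2 landed p646734
`Theorems/…PastFramePeriodic.lean` (`FramePeriodic.framePeriodic_stratum`, bodies verbatim; the weak gradient is hop-invariant a.e., so
the boost needs no separate kill); the CONFINED half of F1 (frame path `‖ξ(τ)‖ ≲ |τ|^β`, `β(1−ρ) < 1`, no Euler equation, E-gauge packing)
is announced by the same hand (`FrameSteady.ae_eq_zero_of_gauge_of_pastFrameSteady_confined`), leaving F1's FAST-FRAME residue to lever
(L2); F3's two delicate steps are typed as first lemmas (`Sig.lemma_affineL32LowerBound`, `Sig.lemma_fictitiousForceConstant`, V48 P2) and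
the re-centring identity (iii) is the checked lemma `isPastWandering_recentre`.

REV3 (width, same day): ns-ezl-w6 g2 landed p648182 `Theorems/…PastFrameSteadyConfined.lean`
(`FrameSteady.ae_eq_zero_of_gauge_of_pastFrameSteady_confined`): a frame-steady member whose frame path is SUB-CRITICALLY CONFINED,
`‖ξ(τ)‖ ≤ K(1+|τ|)^β` with `β(1−ρ) < 1` — NO regularity of `ξ`, NO Euler equation, pure E-gauge packing in continuous time; every affine
path has `β = 1` — is trivial, for all `0 < ρ < 1`.  F1 is therefore RE-CUT: F1c = that theorem BY NAME (checked `frameSteady_confined`,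
predicate `IsSubcriticalFrame`) and the residue F1e `stub_frameSteadyEscaping` (frames escaping at least like `|τ|^{1/(1−ρ)}`; OPEN, M:
this is where lever (L2)/(L3) and the Euler equation enter — the fictitious force `−ξ''·(y − ξ)` in the pressure is constant by the
D-gauge and then zero, so `ξ` is affine, hence confined); `Sig.stub_frameSteady` is now the checked consequence `frameSteady_of`.  The
composition's hypotheses are exactly the four open stubs F1e, F3, F4, F5.  REV3c (critic N65): F1e's plan corrected — by (L1) `η' = 0`, so
a frame-steady member's pressure has NO affine fictitious-force part and the D-gauge is not needed; Euler enters only through (L2), whose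
checkable core is typed as `Sig.lemma_harmonicShearVanishes` (F1e's first lemma); `ξ ∈ C¹` is minimal (the drift is `η₀ − ξ'`), `ξ''` unused.
REV4 (width): F3's first lemma (β) `Sig.lemma_fictitiousForceConstant` is a TREE THEOREM — ns-ezl-w1 g4 landed p651831
`Theorems/…GalileanFictitiousForce.lean` (`…Theorems.PowerGaugeEulerLiouville.GalileanFrames.fictitiousForceConstant`, bodies verbatim):
wired as the checked `lemma_fictitiousForceConstant` (the first KILL by the D-gauge in this directory is now kernel-checked);
REV4b: likewise (α) `Sig.lemma_affineL32LowerBound` := `…GalileanFrames.affineL32LowerBound` (ns-ezl-w1 g4, p648380,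
`Theorems/…GalileanAffineLowerBound.lean`) — BOTH typed first lemmas of F3 are tree theorems; open in F3: the reduction bookkeeping only.
REV5: F1e step (i) (lever L1: the background `η` is constant) is the tree theorem `FrameSteady.background_eq_of_gaugeA` (ns-ezl-w6 g2, p648979),
wired as the checked corollary `frameSteady_background_const` over `InClass`; what remains of F1e is (ii)–(iv): `Sig.lemma_harmonicShearVanishes`
(typed) + the two-time weak-Euler differencing + the affine re-representation.
REV6 (g7): `Sig.lemma_harmonicShearVanishes` IS the tree theorem `GalileanFrames.harmonicShearVanishes` (ns-ezl-w3 g4, p657454,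
`Theorems/…GalileanHarmonicShear.lean`), wired as `lemma_harmonicShearVanishes` (no sorry); open in F1e: the two-time weak-Euler differencing
(`∂_e U = ∇q̃` from frame-steadiness with `ξ ∈ C¹`) + the affine re-representation — bookkeeping, size M.
REV7 (g7): F1e `stub_frameSteadyEscaping` and F1 `stub_frameSteady` ARE tree theorems (ns-ezl-w3 g5 p661610 `GalileanFrames.frameSteadyEscaping` /
`frameSteady_stratum` ← `frameSteady_ae_eq_zero`; LEAD v81 alternative 6 of `IsPastSteady`); sorries 4 → 3 = F3 `stub_wanderingReduce` (TAKEN by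
ns-ezl-w3 g5 19:51Z), F4 `stub_selfSimilarColumn`, F5 `stub_nonGalileanRest`.  No summit is proved by a line; the crux is OPEN.
REV8 (g7, 21:00Z): F3 `stub_wanderingReduce` IS the tree theorem `GalileanFrames.wanderingReduce` (ns-ezl-w3 g5 p665829
`Theorems/…GalileanWandering.lean`, verbatim signature; member-level `wandering_ae_eq_zero_or_selfSimilar` + `wandering_ae_eq_zero_of_drift_ne`
(`…GalileanWanderingKill.lean`) underneath) — wired by name; sorries 3 → 2 = F4 `stub_selfSimilarColumn` (the anchored self-similar column ⊇ THE
NEEDLE, needle-hard, NOT claimed) and F5 `stub_nonGalileanRest` (the non-Galilean rest, NOT claimed).  The Galilean stratum (frame-steady ∪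
frame-periodic ∪ wandering-with-drift) is now CLOSED IN THE TREE; what this chore line set out to do is done.  No summit is proved by a line.

No summit is proved by a line: this file is a skeleton (stubs F1e, F3, F4, F5 are `sorry`; F1c and F2 are tree theorems); its
kernel-checked content is the composition `PowerGaugeEulerLiouville_of`, `frameSteady_confined` / `frameSteady_of` / `stub_framePeriodic`
(by-name wiring), the dictionary lemmas `isPastFrameSteady_of_travelingWave`, `isPastFramePeriodic_of_timePeriodic`,
`isPastWandering_of_selfSimilar` (the LEAD's anchored strata are the `ξ' = const`, `(d,w) = 0`, `ξ = const` slices) and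
`isPastWandering_recentre`.
REV9 (21:55Z, g7): + two CLOSED symmetry strata typed at ns-ezl-w3 g5's request and filled BY NAME — F1r `Sig.stub_rotatingFrameSteady`
(rotating-frame-steady past members, arbitrary isometry path about 0: `RotatingFrame.ae_eq_zero_of_gauge_of_pastRotatingFrameSteady`, p670295
commit d53fd45e16b5) and F1g `Sig.stub_rigidFrameSteadyConfined` (E(3)-steady with sub-critically confined centre:
`RigidFrame.ae_eq_zero_of_gauge_of_pastRigidFrameSteady_confined`, `Theorems/…RigidFrameSteady.lean`).  F4/F5 texts unchanged (F5 may be narrowed by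
«¬ rigid-frame-steady» in a later generation).  Sorries 2 = F4, F5.
REV10 (22:10Z, g7): + F2r `Sig.stub_rotoPeriodic` (roto-periodic past: conjugated by a rigid motion after one period; `R = 1` is F2) CLOSED by
name over ns-ezl-w3 g5 p672323 `RotoPeriodic.ae_eq_zero_of_gauge_of_pastRotoPeriodic` (commit 6ff39fc41db9).  Closed strata now: F1c, F1e, F1r, F1g, F2,
F2r, F3; open: F4 (self-similar column), F5 (rest).  Sorries 2.

-/

noncomputable section

set_option linter.dupNamespace false

open MeasureTheory Set Filter Topology Metric Real
open scoped ENNReal NNReal RealInnerProductSpace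
open Literature.Analysis Literature.Analysis.FluidPDE

namespace Summit.NavierStokesRegularity.NavierStokesRegularity.Cruxes.PowerGaugeEulerLiouville.GalileanFrames

/-- Local abbreviation: ℝ³. -/
abbrev E3 : Type := EuclideanSpace ℝ (Fin 3)

/-- Membership in Seregin's power-gauged ancient Euler class — verbatim the three hypotheses of the crux (same as `Birth.InClass`). -/
@[reducible] def InClass (ρ : ℝ) (u : ℝ → E3 → E3) (p : ℝ → E3 → ℝ) (H : ℝ → E3 → E3 →L[ℝ] E3)
    (c : ℝ≥0) : Prop :=
  IsSuitableWeakSolutionOn (slab (EuclideanSpace ℝ (Fin 3)) (Set.Iio 0) isOpen_Iio) 0 0 u p ∧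
    HasWeakSpatialGradientOn (slab (EuclideanSpace ℝ (Fin 3)) (Set.Iio 0) isOpen_Iio) u H ∧
    (∀ a : ℝ, 0 < a →
      ENNReal.ofReal (a ^ (2 * ρ)) * cknA a (0 : ℝ × E3) u + ENNReal.ofReal (a ^ ρ) * cknE a (0 : ℝ × E3) H +
        ENNReal.ofReal (a ^ (2 * ρ)) * cknD a (0 : ℝ × E3) p ≤ (c : ℝ≥0∞))

/-- The conclusion of the crux: `u` vanishes a.e. on the past slab. -/
@[reducible] def VanishesAE (u : ℝ → E3 → E3) : Prop :=
  Function.uncurry u =ᵐ[volume.restrict (Set.Iio (0 : ℝ) ×ˢ (Set.univ : Set E3))] 0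

/-! ## The objects: relative equilibria modulo the extended Galilei group -/

/-- FRAME-STEADY past (relative equilibrium modulo the extended Galilei group): on a past sub-slab `τ < T₁ ≤ 0`,
`u(τ, y) = U(y − ξ(τ)) + η(τ)` — ONE profile carried along an arbitrary `C¹` frame path `ξ` with an arbitrary uniform background `η`.
`ξ(τ) = τ•b, η = 0` is the LEAD's traveling wave (`isPastFrameSteady_of_travelingWave`); `ξ = 0, η = 0` is `IsPastSteady`.  The background
`η : ℝ → E3` carries NO regularity or measurability BY DESIGN (it is a.e. determined by the member); slice identities are taken at a.e.
times by testing the weak equation with zero-mean divergence-free fields, which do not see `η` (critic V48 P3). -/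
def IsPastFrameSteady (u : ℝ → E3 → E3) : Prop :=
  ∃ (T₁ : ℝ) (U : E3 → E3) (ξ η : ℝ → E3), T₁ ≤ 0 ∧ ContDiff ℝ 1 ξ ∧
    ∀ τ : ℝ, τ < T₁ → u τ = fun y => U (y - ξ τ) + η τ

/-- SUB-CRITICALLY CONFINED frame path on the window `τ < T₁` (ns-ezl-w6 g2's hypothesis, p648182): `‖ξ(τ)‖ ≤ K(1+|τ|)^β` with
`β(1−ρ) < 1`.  Every affine path (traveling wave, `β = 1`) is sub-critical for `ρ > 0`; the complement are frames escaping at least like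
`|τ|^{1/(1−ρ)}` along a sequence. -/
def IsSubcriticalFrame (ρ T₁ : ℝ) (ξ : ℝ → E3) : Prop :=
  ∃ K β : ℝ, 0 ≤ K ∧ β * (1 - ρ) < 1 ∧ ∀ τ : ℝ, τ < T₁ → ‖ξ τ‖ ≤ K * (1 + |τ|) ^ β

/-- FRAME-PERIODIC past (relative periodic orbit modulo Galilei): `u(τ, y) = u(τ − P, y − d) + w` for `τ < T₁ ≤ 0` — periodic up to
a spatial HOP `d` and a BOOST `w`.  `(d, w) = 0` is the time-periodic branch of the LEAD's `IsWeakTamePast` (`isPastFramePeriodic_of_timePeriodic`). -/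
def IsPastFramePeriodic (u : ℝ → E3 → E3) : Prop :=
  ∃ (T₁ P : ℝ) (d w : E3), T₁ ≤ 0 ∧ 0 < P ∧
    ∀ τ : ℝ, τ < T₁ → u τ = fun y => u (τ - P) (y - d) + w

/-- WANDERING self-similar collapse on a past sub-slab: for `τ < T₁` (`T₁ ≤ T`),
`u(τ, y) = (T−τ)^{γ−1} V((T−τ)^{−γ}(y − ξ(τ))) + η(τ)`, `γ = 1/(2+ρ)` — the centre WANDERS along `ξ` and a uniform background `η` drifts.
`ξ ≡ x₀, η ≡ 0` is the LEAD's `IsPastSelfSimilar ρ T T₁ x₀ u V` (`isPastWandering_of_selfSimilar`).  As for `IsPastFrameSteady`, `η` is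
arbitrary by design (a.e. determined by the member; slice identities at a.e. times via zero-mean divergence-free tests). -/
def IsPastWandering (ρ T T₁ : ℝ) (ξ η : ℝ → E3) (u : ℝ → E3 → E3) (V : E3 → E3) : Prop :=
  ∀ τ : ℝ, τ < T₁ → u τ = fun y =>
    (T - τ) ^ (1 / (2 + ρ) - 1) • V ((T - τ) ^ (-(1 / (2 + ρ))) • (y - ξ τ)) + η τ

/-- The member IS a wandering self-similar member (some centre data, `C²` path, background, profile). -/
def IsPastWanderingMember (ρ : ℝ) (u : ℝ → E3 → E3) : Prop :=
  ∃ (T T₁ : ℝ) (ξ η : ℝ → E3) (V : E3 → E3),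
    T₁ ≤ 0 ∧ T₁ ≤ T ∧ ContDiff ℝ 2 ξ ∧ IsPastWandering ρ T T₁ ξ η u V

/-- ANCHORED self-similar member — verbatim the binder shape of the LEAD's `IsPastSelfSimilar ρ T T₁ x₀ u V` (birth v62 l. 359),
existentially closed. -/
def IsPastSelfSimilarMember (ρ : ℝ) (u : ℝ → E3 → E3) : Prop :=
  ∃ (T T₁ : ℝ) (x₀ : E3) (V : E3 → E3), T₁ ≤ 0 ∧ T₁ ≤ T ∧
    ∀ τ : ℝ, τ < T₁ → u τ = fun x => selfSimilarCollapse (1 / (2 + ρ)) T V τ (x - x₀)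

/-! ## Registered stub signatures -/

/-- F1 (M — FRAME-STEADY MEMBERS ARE TRAVELING WAVES, levers L1 + L2): plan — (i) `η` is constant on the window (two-slice A-gauge
comparison on `B_{a/4} ⊂ (B_a − ξ(τ₁)) ∩ (B_a − ξ(τ₂))`, `a → ∞`); absorb it into `Ũ := U + η₀`; (ii) the weak momentum equation at two
times gives `((ξ'(τ₁) − ξ'(τ₂))·∇)Ũ = ∇q` with `q` harmonic (`div Ũ = 0`); (iii) mean-value decay of the harmonic vector `∂_eŨ` under the
slice A-gauge (`∫_{B_R}|Ũ|² ≲ R^{1−2ρ}`): `∂_eŨ ≡ 0` for `e ∈ D := span{ξ'(τ₁) − ξ'(τ₂)}`; (iv) `Ũ` is `D`-invariant and `ξ'` is constant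
modulo `D`, so `u(τ) = Ũ(· − τ b − x₁)`: a traveling wave ⇒ `PastTravel.ae_eq_zero_of_gauge_of_pastTravelingWave` (p600154; the form of
`H` follows from a.e. uniqueness of weak gradients). -/
def Sig.stub_frameSteady : Prop :=
  ∀ ρ : ℝ, 0 < ρ → ρ ≤ 1 / 2 → ∀ (u : ℝ → E3 → E3) (p : ℝ → E3 → ℝ) (H : ℝ → E3 → E3 →L[ℝ] E3) (c : ℝ≥0),
    InClass ρ u p H c → IsPastFrameSteady u → VanishesAE u

/-- F1e (REV3 — the OPEN residue of F1 after ns-ezl-w6 g2's confined theorem; M): a frame-steady member whose `C¹` frame path is NOT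
sub-critically confined is trivial.  PLAN (rev3c, corrected — levers (L1) + (L2); the D-gauge is NOT needed here): (i) (L1) the
background `η` is constant on the window (two-slice A-gauge comparison; every slice obeys the A-bound); (ii) in the frame,
`v(z,τ) := U(z) + c(τ)`, `c := η₀ − ξ'(τ)` (this is why `ξ ∈ C¹` is the MINIMAL regularity: `ξ'` is the drift; `ξ''` is never used —
with `η' = 0` the pressure `p(τ,y) = −Q_{c(τ)}(y − ξ(τ)) + c₀(τ)`, `∇Q_c = ((U + c)·∇)U`, carries NO affine fictitious-force term), and the
weak Euler equation at two a.e. times gives `((c(τ₁) − c(τ₂))·∇)U = ∇q̃` with `q̃` harmonic (`div U = 0`) — lever (L2); (iii) FIRST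
LEMMA `Sig.lemma_harmonicShearVanishes`: an `L²_loc` divergence-free field with the slice A-growth `∫_{B_R}|U + κ|² ≲ R^{1−2ρ}` whose
directional derivative `∂_eU` is weakly a gradient is invariant along `e` (mean value of the harmonic vector `∇q̃` against radial bumps:
`|∇q̃(x₀)| ≲ R^{−5/2}‖U + κ‖_{L²(B_R(x₀))} → 0`); (iv) so `U` is invariant along `D = span{ξ'(τ₁) − ξ'(τ₂)}` and `u(τ) = U(· − ξ₀ − τ ξ₁)`
for an AFFINE path: apply F1c (`β = 1`) to that representation (the hypothesis `¬ IsSubcriticalFrame` on the given `ξ` is not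
contradicted — it is bypassed).  Why it might fail: only the distributional bookkeeping (`η` arbitrary: test against zero-mean
divergence-free fields at a.e. times; a.e.-in-`τ` identities from the space–time weak form). -/
def Sig.stub_frameSteadyEscaping : Prop :=
  ∀ ρ : ℝ, 0 < ρ → ρ ≤ 1 / 2 → ∀ (u : ℝ → E3 → E3) (p : ℝ → E3 → ℝ) (H : ℝ → E3 → E3 →L[ℝ] E3) (c : ℝ≥0),
    InClass ρ u p H c → ∀ (T₁ : ℝ) (U : E3 → E3) (ξ η : ℝ → E3), T₁ ≤ 0 → ContDiff ℝ 1 ξ →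
      (∀ τ : ℝ, τ < T₁ → u τ = fun y => U (y - ξ τ) + η τ) → ¬ IsSubcriticalFrame ρ T₁ ξ → VanishesAE u

/-- F1r (REV9, g7 — ROTATING-FRAME-STEADY MEMBERS ARE TRIVIAL; the «tumbling / spinning / reflecting» stratum next to F1c/F1e): a class
member that is, on a past window, a FIXED profile seen in a frame rotating about the origin along an ARBITRARY isometry path
`R : ℝ → E3 ≃ₗᵢ[ℝ] E3` (no regularity in `τ`), plus a background `η τ`, vanishes.  Why it is easy (ns-ezl-w3 g5): the E-gauge is blind to
rotations about `0`, so ONE profile gradient `G₀` carries every slice (weak derivatives transport under linear isometries) and the slice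
budget `a^ρ E(a) ≤ c` packs to `G₀ = 0`.  Typed at ns-ezl-w3 g5's request (21:34Z) with the binder shape of
`RotatingFrame.ae_eq_zero_of_gauge_of_pastRotatingFrameSteady`; closed by name below as soon as that file is in the tree. -/
def Sig.stub_rotatingFrameSteady : Prop :=
  ∀ ρ : ℝ, 0 < ρ → ρ ≤ 1 / 2 → ∀ (u : ℝ → E3 → E3) (p : ℝ → E3 → ℝ) (H : ℝ → E3 → E3 →L[ℝ] E3) (c : ℝ≥0),
    InClass ρ u p H c → ∀ (T₁ : ℝ) (U : E3 → E3) (R : ℝ → E3 ≃ₗᵢ[ℝ] E3) (η : ℝ → E3), T₁ ≤ 0 →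
      (∀ τ : ℝ, τ < T₁ → u τ = fun y => R τ (U ((R τ).symm y)) + η τ) → VanishesAE u

/-- F1g (REV9, g7 — RIGID-FRAME-STEADY = E(3)-STEADY PAST MEMBERS WITH SUB-CRITICALLY CONFINED CENTRE ARE TRIVIAL; F1c = `R ≡ id`,
F1r = `ξ ≡ 0`): `u τ = R τ (U ((R τ).symm (y − ξ τ))) + η τ` on a past window with `‖ξ τ‖ ≤ K (1+|τ|)^β`, `β(1−ρ) < 1`, vanishes — any
isometry path `R`, any profile, any background, no Euler equation (ns-ezl-w3 g5 `RigidFrame.ae_eq_zero_of_gauge_of_pastRigidFrameSteady_confined`,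
binders of F1c with the member form rotated).  Typed at ns-ezl-w3 g5's suggestion (21:38Z), closed by name below. -/
def Sig.stub_rigidFrameSteadyConfined : Prop :=
  ∀ ρ : ℝ, 0 < ρ → ρ ≤ 1 / 2 → ∀ (u : ℝ → E3 → E3) (p : ℝ → E3 → ℝ) (H : ℝ → E3 → E3 →L[ℝ] E3) (c : ℝ≥0),
    InClass ρ u p H c → ∀ (T₁ : ℝ) (U : E3 → E3) (R : ℝ → E3 ≃ₗᵢ[ℝ] E3) (ξ η : ℝ → E3), T₁ ≤ 0 →
      (∀ τ : ℝ, τ < T₁ → u τ = fun y => R τ (U ((R τ).symm (y - ξ τ))) + η τ) → IsSubcriticalFrame ρ T₁ ξ → VanishesAE u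

/-- F2 (S/M — HOPPING ORBITS, lever L1 + E-gauge arithmetic): plan — (i) the boost vanishes: `‖w‖_{L²(B_{a/2})} ≤ ‖u(τ)‖_{L²(B_a)} +
‖u(τ−P)‖_{L²(B_a)}` for `a ≥ 2|d|`, so `|w|² a³ ≲ a^{1−2ρ}`; (ii) with `w = 0`, `∫_{B_a}‖H(τ₀ − kP)‖² = ∫_{B_a(−kd)}‖H(τ₀)‖² ≥ ∫_{B_{a/2}}‖H(τ₀)‖²`
for `k ≤ a/(2|d|)`, so the E-gauge `∫_{−a²}^{0}∫_{B_a}‖H‖² ≤ c a^{1−ρ}` spread over `N ≍ a/|d|` periods gives `∫_{period}∫_{B_{a/2}}‖H‖² ≲ |d| a^{−ρ} → 0`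
(`d = 0`: `N ≍ a²/P`, the LEAD's periodic arithmetic p599372); (iii) `H = 0` on a period ⇒ slices constant ⇒ zero by the A-gauge ⇒ the whole
window is quiescent by hopping-periodicity ⇒ `ae_eq_zero_of_gauge_of_energyVanishing_allRho`. -/
def Sig.stub_framePeriodic : Prop :=
  ∀ ρ : ℝ, 0 < ρ → ρ ≤ 1 / 2 → ∀ (u : ℝ → E3 → E3) (p : ℝ → E3 → ℝ) (H : ℝ → E3 → E3 →L[ℝ] E3) (c : ℝ≥0),
    InClass ρ u p H c → IsPastFramePeriodic u → VanishesAE u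

/-- F2r (REV10, g7 — ROTO-PERIODIC PAST MEMBERS ARE TRIVIAL; the relative-periodic-orbit stratum modulo the full Euclidean group): after
one period `P > 0` the member returns CONJUGATED by a rigid motion `y ↦ R y + d` (`R : E3 ≃ₗᵢ[ℝ] E3` arbitrary, incl. irrational rotations and
reflections) and boosted by `w`: `u τ = fun y => R (u (τ − P) (R.symm (y − d))) + w` for `τ < T₁ ≤ 0`.  `R = 1` is F2 (`IsPastFramePeriodic`);
an irrational `R` is NOT reducible to F2.  Typed at ns-ezl-w3 g5's suggestion (22:03Z, `RotoPeriodic.ae_eq_zero_of_gauge_of_pastRotoPeriodic`);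
closed by name below once that file is in the tree. -/
def Sig.stub_rotoPeriodic : Prop :=
  ∀ ρ : ℝ, 0 < ρ → ρ ≤ 1 / 2 → ∀ (u : ℝ → E3 → E3) (p : ℝ → E3 → ℝ) (H : ℝ → E3 → E3 →L[ℝ] E3) (c : ℝ≥0),
    InClass ρ u p H c → ∀ (T₁ P : ℝ) (R : E3 ≃ₗᵢ[ℝ] E3) (d w : E3), T₁ ≤ 0 → 0 < P →
      (∀ τ : ℝ, τ < T₁ → u τ = fun y => R (u (τ - P) (R.symm (y - d))) + w) → VanishesAE u

/-- F3 (M/L — WANDERING CENTRES ARE RE-CENTRINGS, BOOSTS VANISH; levers L1 + L2 + L3; the first use of the PRESSURE gauge as a kill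
in this crux directory): a wandering self-similar member is either trivial or an ANCHORED self-similar member.  Plan — (i) drift
`c(τ) := (T−τ)^{1−γ}(η − ξ')`: two-time differences of the (forced, drifted) profile equation give `((c(τ₁) − c(τ₂))·∇)V = ∇q`, `Δq = 0`,
so by mean-value decay `V` is invariant along `D = span{c(τ₁) − c(τ₂)}`; if `D ≠ 0` a `D`-invariant profile with `∫_{B_L}|V + κ|² ≲ L^{1−2ρ}`
vanishes (`∫_{disc(L/2)}|V + κ|² ≲ L^{−2ρ} → 0`), so `u` is spatially constant on the window ⇒ `VanishesAE` via the quiescent filler;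
if `D = 0`, `η = ξ' + c₀(T−τ)^{γ−1}` and `c₀` is absorbed into `V`; (ii) weak Euler ⇒ `p(τ,y) = (T−τ)^{2γ−2}[P̄(Y) − b(τ)·Y + c₁(τ)]` with
`b = (T−τ)^{2−γ}ξ''`; the D-gauge and the two-point affine lower bound `inf_c ∫_{B_L}|(b₁−b₂)·Y − c|^{3/2} ≳ |b₁−b₂|^{3/2}L^{9/2}` force `b`
a.e. constant `= ℓ`; (iii) `ξ = x₀ + w(τ−T) + m(T−τ)^γ`, `m = ℓ/(γ(γ−1))`, and `V(· − m) − γ m` re-centres: `u(τ) = SS_{Ṽ}(τ, · − x₀ − w(τ−T)) + w`;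
(iv) `w = 0` by the two-slice A-gauge comparison in similarity variables (`∫_{B_r(Y₀(τ))}|Ṽ + (T−τ)^{1−γ}w|² ≲ r^{1−2ρ}`, nested balls,
two times). -/
def Sig.stub_wanderingReduce : Prop :=
  ∀ ρ : ℝ, 0 < ρ → ρ ≤ 1 / 2 → ∀ (u : ℝ → E3 → E3) (p : ℝ → E3 → ℝ) (H : ℝ → E3 → E3 →L[ℝ] E3) (c : ℝ≥0),
    InClass ρ u p H c → IsPastWanderingMember ρ u → VanishesAE u ∨ IsPastSelfSimilarMember ρ u

/-- F4 (= THE PAST-WINDOW ANCHORED SELF-SIMILAR COLUMN — NOT claimed by this line; listed so that the partition closes; label =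
critic V48 P1): an anchored self-similar member of the class — the LEAD's binder `IsPastSelfSimilar ρ T T₁ x₀ u V` existentially
closed over ANY centre `(T, x₀)`, ANY profile `V`, on a past window — is trivial.  That set is the LEAD's FILLED past-window strata
(`IsPastSelfSimilarClassical`, `IsPastSelfSimilarSubExtremal`, `IsShapeFastClock`, …) ∪ the origin-anchored OPEN residues
`stub_selfSimilarC2Needle` / `stub_selfSimilarWeakRest` (typed with `IsExactlySelfSimilar ρ u p V P`, whole slab, centre `(0,0)`) ∪ the
OFF-CENTRE / INTERIOR-TIME extremal needles which, per the standing N55 memo, currently sit inside `stub_nonSelfSimilarRest`; every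
open part stays OPEN (needle-hard; width of this line on the needle = 0, declared). -/
def Sig.stub_selfSimilarColumn : Prop :=
  ∀ ρ : ℝ, 0 < ρ → ρ ≤ 1 / 2 → ∀ (u : ℝ → E3 → E3) (p : ℝ → E3 → ℝ) (H : ℝ → E3 → E3 →L[ℝ] E3) (c : ℝ≥0),
    InClass ρ u p H c → IsPastSelfSimilarMember ρ u → VanishesAE u

/-- F5 (OPEN residue — the complement of the stratum; the crux restricted, NOT claimed): members that are neither frame-steady, nor
frame-periodic, nor wandering self-similar. -/
def Sig.stub_nonGalileanRest : Prop :=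
  ∀ ρ : ℝ, 0 < ρ → ρ ≤ 1 / 2 → ∀ (u : ℝ → E3 → E3) (p : ℝ → E3 → ℝ) (H : ℝ → E3 → E3 →L[ℝ] E3) (c : ℝ≥0),
    InClass ρ u p H c → ¬ IsPastFrameSteady u → ¬ IsPastFramePeriodic u → ¬ IsPastWanderingMember ρ u → VanishesAE u

/-! ## First lemmas of F3 (typed, critic V48 P2 — NOT stubs of the composition) -/

/-- FIRST LEMMA (α) of F3 (S, pure analysis): the TWO-POINT AFFINE `L^{3/2}` LOWER BOUND — an affine function `Y ↦ ⟪b, Y⟫ − c` has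
`∫_{B_L} |⟪b,Y⟫ − c|^{3/2} dY ≥ κ ‖b‖^{3/2} L^{9/2}` uniformly in the constant `c` (scaling `Y = L Z` and
`κ = inf_{c'} ∫_{B_1}|Z₁ − c'|^{3/2} > 0`).  This is the quantitative heart of lever (L3). -/
def Sig.lemma_affineL32LowerBound : Prop :=
  ∃ κ : ℝ, 0 < κ ∧ ∀ (b : E3) (c L : ℝ), 0 < L →
    κ * ‖b‖ ^ (3 / 2 : ℝ) * L ^ (9 / 2 : ℝ) ≤ ∫ Y in Metric.ball (0 : E3) L, |⟪b, Y⟫ - c| ^ (3 / 2 : ℝ)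

/-- FIRST LEMMA (β) of F3 (M, member level): FICTITIOUS FORCES ARE CONSTANT UNDER THE PRESSURE GAUGE.  If a member's pressure has the
co-moving similarity form `p(τ,y) = (T−τ)^{2γ−2} [P̄(Y) − ⟪b(τ), Y⟫ + c₁(τ)]`, `Y = (T−τ)^{−γ}(y − ξ(τ))`, with ONE profile pressure
`P̄`, a measurable force coefficient `b` and any `c₁`, then `b` is a.e. constant on the window: two essential values `b₁ ≠ b₂` on
bounded positive-measure time sets would give, by (α) and the triangle inequality against the one `P̄`, slices with
`∫_{B_a}|p|^{3/2} ≳ |b₁ − b₂|^{3/2} a^{9/2}`, against the D-gauge `∫_{−a²}^{0}∫_{B_a}|p|^{3/2} ≤ c a^{2−2ρ}` (Chebyshev in time) — the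
first use of `cknD` as a KILL in this crux directory.  In F3, `b(τ) = (T−τ)^{2−γ} ξ''(τ)` (continuous), so `ξ'' = ℓ (T−τ)^{γ−2}`.
WHERE THE BUDGET LIVES (critic N62): the local `L^{3/2}` pressure budget is the THIRD conjunct of `InClass ρ u p H c` — from
`h.2.2 a ha : ofReal (a^{2ρ})·cknA a 0 u + ofReal (a^ρ)·cknE a 0 H + ofReal (a^{2ρ})·cknD a 0 p ≤ c` drop the first two summands
(`le_add_self`) to get `ofReal (a^{2ρ}) * cknD a (0 : ℝ × E3) p ≤ c`, i.e. `∫_{−a²}^{0}∫_{B_a} |p|^{3/2} ≤ c a^{2−2ρ}` in the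
`Literature.Analysis.FluidPDE.cknD` normalisation (the same extraction as `hE`/`hA` in the tree's `FrameSteady`/`WindowIdentity` files). -/
def Sig.lemma_fictitiousForceConstant : Prop :=
  ∀ ρ : ℝ, 0 < ρ → ρ ≤ 1 / 2 → ∀ (u : ℝ → E3 → E3) (p : ℝ → E3 → ℝ) (H : ℝ → E3 → E3 →L[ℝ] E3) (c : ℝ≥0)
    (T T₁ : ℝ) (ξ : ℝ → E3) (Pbar : E3 → ℝ) (b : ℝ → E3) (c₁ : ℝ → ℝ),
    InClass ρ u p H c → T₁ ≤ 0 → T₁ ≤ T → ContDiff ℝ 2 ξ → Measurable b →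
    (∀ τ : ℝ, τ < T₁ → p τ = fun y =>
        (T - τ) ^ (2 * (1 / (2 + ρ)) - 2) *
          (Pbar ((T - τ) ^ (-(1 / (2 + ρ))) • (y - ξ τ)) - ⟪b τ, (T - τ) ^ (-(1 / (2 + ρ))) • (y - ξ τ)⟫ + c₁ τ)) →
    ∃ b₀ : E3, ∀ᵐ τ ∂(volume.restrict (Set.Iio T₁)), b τ = b₀

/-- FIRST LEMMA of F1e (typed, critic N65; S/M, pure analysis = lever (L2) made checkable): HARMONIC SHEAR VANISHES UNDER THE A-GAUGE.
A locally integrable field `U` on `ℝ³` that is weakly divergence-free, has the slice growth `∫_{B_R} |U + κ|² ≤ C R^{1−2ρ}` (`R ≥ 1`, some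
constant `κ`; lower Lebesgue integral: junk-free) and whose directional derivative `∂_e U` is WEAKLY A GRADIENT — i.e. orthogonal to every
smooth compactly supported divergence-free field `Φ`: `∫ ⟪U, ∂_eΦ⟫ = 0` (de Rham) — is invariant under translations along `e`.  Proof
sketch: `∂_eU = ∇q̃`, `Δq̃ = ∂_e div U = 0`, mean value of the harmonic vector `∇q̃` against a radial bump `ψ_R(· − x₀)`:
`|∇q̃(x₀)| = |∫ U ∂_eψ_R| ≲ R^{−4} R^{3/2} ‖U + κ‖_{L²(B_R(x₀))} ≲ R^{−5/2} (R + |x₀|)^{1/2−ρ} → 0`; a distribution with `∂_eU = 0` is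
`e`-translation invariant (mollify). -/
def Sig.lemma_harmonicShearVanishes : Prop :=
  ∀ ρ : ℝ, 0 < ρ → ∀ (U : E3 → E3) (κ e : E3) (C : ℝ),
    LocallyIntegrable U volume →
    (∀ R : ℝ, 1 ≤ R → ∫⁻ z in Metric.ball (0 : E3) R, ‖U z + κ‖ₑ ^ 2 ≤ ENNReal.ofReal (C * R ^ (1 - 2 * ρ))) →
    (∀ φ : E3 → ℝ, ContDiff ℝ (⊤ : ℕ∞) φ → HasCompactSupport φ → ∫ z, ⟪U z, gradient φ z⟫ = 0) →
    (∀ Φ : E3 → E3, ContDiff ℝ (⊤ : ℕ∞) Φ → HasCompactSupport Φ →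
      (∀ z, LinearMap.trace ℝ E3 ((fderiv ℝ Φ z : E3 →L[ℝ] E3) : E3 →ₗ[ℝ] E3) = 0) →
      ∫ z, ⟪U z, (fderiv ℝ Φ z) e⟫ = 0) →
    ∀ s : ℝ, (fun z => U (z + s • e)) =ᵐ[volume] U

/-- F1e's FIRST LEMMA is a TREE THEOREM by name (rev6, 2026-08-28 g7): ns-ezl-w3 g4, p657454 ACCEPTED
`Theorems/EulerZoomLiouvillePowerGaugeEulerLiouvilleGalileanHarmonicShear.lean` — `GalileanFrames.harmonicShearVanishes` (body verbatim
= `Sig.lemma_harmonicShearVanishes`; proof: the increment `U(·+se) − U` is weakly curl-free AND divergence-free with A-slice growth, hence a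
harmonic gradient of sub-linear growth, hence zero).  No sorry. -/
theorem lemma_harmonicShearVanishes : Sig.lemma_harmonicShearVanishes :=
  Summit.NavierStokesRegularity.NavierStokesRegularity.Theorems.PowerGaugeEulerLiouville.GalileanFrames.harmonicShearVanishes

/-- F1e STEP (i) = lever (L1) is a TREE THEOREM by name (rev5): the uniform background of a frame-steady past member is CONSTANT on the
window — `FrameSteady.background_eq_of_gaugeA` (ns-ezl-w6 g2 tools, p648979; every `ρ > −1`, A-gauge only).  No sorry. -/
theorem frameSteady_background_const {ρ : ℝ} {u : ℝ → E3 → E3} {p : ℝ → E3 → ℝ} {H : ℝ → E3 → E3 →L[ℝ] E3} {c : ℝ≥0}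
    (hρ : 0 < ρ) (h : InClass ρ u p H c) {T₁ : ℝ} {U : E3 → E3} {ξ η : ℝ → E3} (hT₁ : T₁ ≤ 0)
    (hu : ∀ τ : ℝ, τ < T₁ → u τ = fun y => U (y - ξ τ) + η τ) {τ₁ τ₂ : ℝ} (hτ₁ : τ₁ < T₁) (hτ₂ : τ₂ < T₁) :
    η τ₁ = η τ₂ :=
  Summit.NavierStokesRegularity.NavierStokesRegularity.Theorems.PowerGaugeEulerLiouville.FrameSteady.background_eq_of_gaugeA
    h.2.1 hT₁ hu (by linarith) (fun a ha => le_trans (le_trans le_self_add le_self_add) (h.2.2 a ha)) hτ₁ hτ₂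

/-- (α) is LANDED BY NAME (rev4b): ns-ezl-w1 g4, p648380 ACCEPTED `Theorems/…GalileanAffineLowerBound.lean`.  No sorry. -/
theorem lemma_affineL32LowerBound : Sig.lemma_affineL32LowerBound :=
  Summit.NavierStokesRegularity.NavierStokesRegularity.Theorems.PowerGaugeEulerLiouville.GalileanFrames.affineL32LowerBound

/-- (β) is LANDED BY NAME (rev4): ns-ezl-w1 g4, p651831 ACCEPTED `Theorems/…GalileanFictitiousForce.lean`.  No sorry. -/
theorem lemma_fictitiousForceConstant : Sig.lemma_fictitiousForceConstant :=
  Summit.NavierStokesRegularity.NavierStokesRegularity.Theorems.PowerGaugeEulerLiouville.GalileanFrames.fictitiousForceConstant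

/-- F1r is FILLED BY NAME (REV9, g7): width ns-ezl-w3 g5, p670295 ACCEPTED `Theorems/…RotatingFrameSteady.lean` (commit d53fd45e16b5)
— rotating-frame-steady past members (arbitrary isometry path about the origin, any profile, any background) are trivial for all `0 < ρ < 1`;
no Euler equation used.  No sorry. -/
theorem stub_rotatingFrameSteady : Sig.stub_rotatingFrameSteady :=
  fun ρ hρ hρh u p H c h T₁ U R η hT₁ hu =>
    Summit.NavierStokesRegularity.NavierStokesRegularity.Theorems.PowerGaugeEulerLiouville.RotatingFrame.ae_eq_zero_of_gauge_of_pastRotatingFrameSteady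
      hρ (by linarith) h.1 h.2.1 h.2.2 hT₁ hu

/-- F1g is FILLED BY NAME (REV9, g7): width ns-ezl-w3 g5, `Theorems/…RigidFrameSteady.lean` ACCEPTED (21:4xZ) — rigid-frame-steady past
members with sub-critically confined centre are trivial for all `0 < ρ < 1`.  No sorry. -/
theorem stub_rigidFrameSteadyConfined : Sig.stub_rigidFrameSteadyConfined := by
  intro ρ hρ hρh u p H c h T₁ U R ξ η hT₁ hu hξ
  obtain ⟨K, β, hK, hβ, hb⟩ := hξ
  exact
    Summit.NavierStokesRegularity.NavierStokesRegularity.Theorems.PowerGaugeEulerLiouville.RigidFrame.ae_eq_zero_of_gauge_of_pastRigidFrameSteady_confined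
      hρ (by linarith) h.1 h.2.1 h.2.2 hT₁ hu hK hβ hb

/-- F2r is FILLED BY NAME (REV10, g7): width ns-ezl-w3 g5, p672323 ACCEPTED `Theorems/…RotoPeriodic.lean` (commit 6ff39fc41db9) —
roto-periodic past members are trivial for every `ρ > 0` (E-gauge arithmetic over `N ≍ a/|d|` periods, rotation-blind).  No sorry. -/
theorem stub_rotoPeriodic : Sig.stub_rotoPeriodic :=
  fun _ hρ _ _ _ _ _ h _ _ _ _ _ hT₁ hP hu =>
    Summit.NavierStokesRegularity.NavierStokesRegularity.Theorems.PowerGaugeEulerLiouville.RotoPeriodic.ae_eq_zero_of_gauge_of_pastRotoPeriodic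
      hρ h.1 h.2.1 h.2.2 hT₁ hP hu

/-! ## Stubs (the `sorry`s of this skeleton — F1e, F3, F4, F5; F1c and F2 are tree theorems) -/

/-- F1c is FILLED BY NAME (rev3): width ns-ezl-w6 g2, p648182 ACCEPTED `Theorems/…PastFrameSteadyConfined.lean` — confined frames,
any profile / background / frame path, no Euler equation, all `0 < ρ < 1`. -/
theorem frameSteady_confined {ρ : ℝ} (hρ : 0 < ρ) (hρ1 : ρ < 1) {u : ℝ → E3 → E3} {p : ℝ → E3 → ℝ}
    {H : ℝ → E3 → E3 →L[ℝ] E3} {c : ℝ≥0} (h : InClass ρ u p H c) {T₁ : ℝ} {U : E3 → E3} {ξ η : ℝ → E3} (hT₁ : T₁ ≤ 0)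
    (hu : ∀ τ : ℝ, τ < T₁ → u τ = fun y => U (y - ξ τ) + η τ) (hξ : IsSubcriticalFrame ρ T₁ ξ) : VanishesAE u := by
  obtain ⟨K, β, hK, hβ, hb⟩ := hξ
  exact
    Summit.NavierStokesRegularity.NavierStokesRegularity.Theorems.PowerGaugeEulerLiouville.FrameSteady.ae_eq_zero_of_gauge_of_pastFrameSteady_confined
      hρ hρ1 h.1 h.2.1 h.2.2 hT₁ hu hK hβ hb

/-- F1e is FILLED BY NAME (REV7, g7): width ns-ezl-w3 g5, p661610 ACCEPTED `Theorems/…GalileanFrameSteady.lean`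
(`GalileanFrames.frameSteadyEscaping`, body verbatim with the line defs unfolded; underlying kill
`GalileanFrames.frameSteady_ae_eq_zero`: EVERY frame-steady past member with a `C¹` frame path is trivial — the escaping binder is idle). -/
theorem stub_frameSteadyEscaping : Sig.stub_frameSteadyEscaping :=
  Summit.NavierStokesRegularity.NavierStokesRegularity.Theorems.PowerGaugeEulerLiouville.GalileanFrames.frameSteadyEscaping

/-- F1 = F1c (tree) + F1e (stub): checked. -/
theorem frameSteady_of (h1e : Sig.stub_frameSteadyEscaping) : Sig.stub_frameSteady := by
  intro ρ hρ hle u p H c hcls hfs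
  obtain ⟨T₁, U, ξ, η, hT₁, hξ1, hu⟩ := hfs
  by_cases hconf : IsSubcriticalFrame ρ T₁ ξ
  · exact frameSteady_confined hρ (by linarith) hcls hT₁ hu hconf
  · exact h1e ρ hρ hle u p H c hcls T₁ U ξ η hT₁ hξ1 hu hconf

theorem stub_frameSteady : Sig.stub_frameSteady :=
  frameSteady_of stub_frameSteadyEscaping

/-- F1 directly BY NAME (REV7): `GalileanFrames.frameSteady_stratum` (ns-ezl-w3 g5, p661610) — the F1c/F1e split is now optional. -/
theorem stub_frameSteady' : Sig.stub_frameSteady :=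
  Summit.NavierStokesRegularity.NavierStokesRegularity.Theorems.PowerGaugeEulerLiouville.GalileanFrames.frameSteady_stratum

/-- F2 is FILLED BY NAME (rev2): width ns-ezl-w6 g2, p646734 ACCEPTED `Theorems/…PastFramePeriodic.lean`. -/
theorem stub_framePeriodic : Sig.stub_framePeriodic :=
  Summit.NavierStokesRegularity.NavierStokesRegularity.Theorems.PowerGaugeEulerLiouville.FramePeriodic.framePeriodic_stratum

theorem stub_wanderingReduce : Sig.stub_wanderingReduce := by
  intro ρ hρ hρ2 u p H c hcl hW
  obtain ⟨T, T₁, ξ, η, V, hT₁, hT, hξ, hu⟩ := hW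
  rcases Summit.NavierStokesRegularity.NavierStokesRegularity.Theorems.PowerGaugeEulerLiouville.GalileanFrames.wanderingReduce
      ρ hρ hρ2 u p H c hcl ⟨T, T₁, ξ, η, V, hT₁, hT, hξ, hu⟩ with h0 | ⟨T', T₁', x₀, W, hT₁', hT', hW'⟩
  · exact Or.inl h0
  · exact Or.inr ⟨T', T₁', x₀, W, hT₁', hT', hW'⟩

theorem stub_selfSimilarColumn : Sig.stub_selfSimilarColumn := by
  sorry

theorem stub_nonGalileanRest : Sig.stub_nonGalileanRest := by
  sorry

/-! ## Composition (kernel-checked): the five stubs conclude the crux BY NAME -/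

theorem PowerGaugeEulerLiouville_of :
    Sig.stub_frameSteadyEscaping → Sig.stub_wanderingReduce → Sig.stub_selfSimilarColumn → Sig.stub_nonGalileanRest →
      Summit.NavierStokesRegularity.NavierStokesRegularity.Theses.EulerZoomLiouville.PowerGaugeEulerLiouville := by
  intro h1e h3 h4 h5 ρ hρ u p H c hsw hH hc
  have h1 : Sig.stub_frameSteady := frameSteady_of h1e
  have h2 : Sig.stub_framePeriodic := stub_framePeriodic
  by_cases hhalf : 1 / 2 < ρ
  · exact
      Summit.NavierStokesRegularity.NavierStokesRegularity.Theorems.PowerGaugeEulerLiouville.powerGaugeEulerLiouville_largeRho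
        ρ hhalf u p H c hsw hH hc
  · have hρ2 : ρ ≤ 1 / 2 := not_lt.mp hhalf
    have hIn : InClass ρ u p H c := ⟨hsw, hH, hc⟩
    by_cases hFs : IsPastFrameSteady u
    · exact h1 ρ hρ hρ2 u p H c hIn hFs
    · by_cases hFp : IsPastFramePeriodic u
      · exact h2 ρ hρ hρ2 u p H c hIn hFp
      · by_cases hW : IsPastWanderingMember ρ u
        · rcases h3 ρ hρ hρ2 u p H c hIn hW with hzero | hss
          · exact hzero
          · exact h4 ρ hρ hρ2 u p H c hIn hss
        · exact h5 ρ hρ hρ2 u p H c hIn hFs hFp hW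

/-! ## Dictionary lemmas (kernel-checked; not stubs, not used by the composition) -/

/-- The LEAD's traveling wave (`u τ = fun y => U (y - τ • b)`, p600154) is frame-steady with the affine path `ξ(τ) = τ•b` and no background. -/
theorem isPastFrameSteady_of_travelingWave {u : ℝ → E3 → E3} {T₁ : ℝ} (hT₁ : T₁ ≤ 0) {U : E3 → E3} {b : E3}
    (hu : ∀ τ : ℝ, τ < T₁ → u τ = fun y => U (y - τ • b)) : IsPastFrameSteady u := by
  refine ⟨T₁, U, fun τ => τ • b, fun _ => 0, hT₁, ?_, fun τ hτ => ?_⟩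
  · exact contDiff_id.smul contDiff_const
  · rw [hu τ hτ]
    funext y
    simp

/-- The LEAD's past-steady stratum (`u τ = v`) is frame-steady with the constant path and no background. -/
theorem isPastFrameSteady_of_pastSteady {u : ℝ → E3 → E3} {T₁ : ℝ} (hT₁ : T₁ ≤ 0) {v : E3 → E3}
    (hu : ∀ τ : ℝ, τ < T₁ → u τ = v) : IsPastFrameSteady u := by
  refine ⟨T₁, v, fun _ => 0, fun _ => 0, hT₁, contDiff_const, fun τ hτ => ?_⟩
  rw [hu τ hτ]
  funext y
  simp

/-- The time-periodic branch of the LEAD's `IsWeakTamePast` (`u (τ - P) = u τ` for `τ < T₁`) is frame-periodic with no hop and no boost. -/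
theorem isPastFramePeriodic_of_timePeriodic {u : ℝ → E3 → E3} {T₁ P : ℝ} (hT₁ : T₁ ≤ 0) (hP : 0 < P)
    (hu : ∀ τ : ℝ, τ < T₁ → u (τ - P) = u τ) : IsPastFramePeriodic u := by
  refine ⟨T₁, P, 0, 0, hT₁, hP, fun τ hτ => ?_⟩
  rw [← hu τ hτ]
  funext y
  simp

/-- The LEAD's anchored self-similar stratum (`IsPastSelfSimilar ρ T T₁ x₀ u V`, via `selfSimilarCollapse`) is the wandering stratum
with the constant path `ξ ≡ x₀` and no background. -/
theorem isPastWandering_of_selfSimilar {ρ T T₁ : ℝ} {x₀ : E3} {u : ℝ → E3 → E3} {V : E3 → E3}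
    (hu : ∀ τ : ℝ, τ < T₁ → u τ = fun x => selfSimilarCollapse (1 / (2 + ρ)) T V τ (x - x₀)) :
    IsPastWandering ρ T T₁ (fun _ => x₀) (fun _ => 0) u V := by
  intro τ hτ
  rw [hu τ hτ]
  funext y
  simp [selfSimilarCollapse_apply]

/-- Conversely a wandering member with constant path and zero background is an anchored self-similar member (so F3's second
disjunct is the honest hand-over to the LEAD's column F4). -/
theorem isPastSelfSimilarMember_of_wandering_const {ρ T T₁ : ℝ} (hT₁ : T₁ ≤ 0) (hT : T₁ ≤ T) {x₀ : E3}
    {u : ℝ → E3 → E3} {V : E3 → E3} (hu : IsPastWandering ρ T T₁ (fun _ => x₀) (fun _ => 0) u V) :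
    IsPastSelfSimilarMember ρ u := by
  refine ⟨T, T₁, x₀, V, hT₁, hT, fun τ hτ => ?_⟩
  rw [hu τ hτ]
  funext y
  simp [selfSimilarCollapse_apply]

/-- RE-CENTRING IDENTITY (step (iii) of F3, critic V48 P2; pure algebra on the ansatz): a wandering member whose centre is
`ξ(τ) = x₀ + (τ−T)w + (T−τ)^γ m` and whose background is `w + (T−τ)^{γ−1} c₀` IS a wandering member about the UNIFORMLY MOVING centre
`x₀ + (τ−T)w` with CONSTANT background `w` (a boosted anchored member) and the re-centred profile `Z ↦ V(Z − m) + c₀` — the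
`(T−τ)^γ m` excursion is the similarity translation, not a force. -/
theorem isPastWandering_recentre {ρ T T₁ : ℝ} {x₀ w m c₀ : E3} {u : ℝ → E3 → E3} {V : E3 → E3} (hT : T₁ ≤ T)
    (hu : IsPastWandering ρ T T₁ (fun τ => x₀ + (τ - T) • w + (T - τ) ^ (1 / (2 + ρ)) • m)
      (fun τ => w + (T - τ) ^ (1 / (2 + ρ) - 1) • c₀) u V) :
    IsPastWandering ρ T T₁ (fun τ => x₀ + (τ - T) • w) (fun _ => w) u (fun Z => V (Z - m) + c₀) := by
  intro τ hτ
  have hpos : 0 < T - τ := by linarith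
  have h1 : (T - τ) ^ (-(1 / (2 + ρ))) * (T - τ) ^ (1 / (2 + ρ)) = 1 := by
    rw [Real.rpow_neg hpos.le, inv_mul_cancel₀ (Real.rpow_pos_of_pos hpos _).ne']
  rw [hu τ hτ]
  funext y
  have key : (T - τ) ^ (-(1 / (2 + ρ))) • (y - (x₀ + (τ - T) • w + (T - τ) ^ (1 / (2 + ρ)) • m)) =
      (T - τ) ^ (-(1 / (2 + ρ))) • (y - (x₀ + (τ - T) • w)) - m := by
    rw [show y - (x₀ + (τ - T) • w + (T - τ) ^ (1 / (2 + ρ)) • m) =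
        (y - (x₀ + (τ - T) • w)) - (T - τ) ^ (1 / (2 + ρ)) • m by abel, smul_sub, smul_smul, h1, one_smul]
  simp only [key, smul_add]
  abel

end Summit.NavierStokesRegularity.NavierStokesRegularity.Cruxes.PowerGaugeEulerLiouville.GalileanFrames

end
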